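import Summits.CriticalPhenomena.Ising3DConformalLimit.Theorems.PerfectScreeningGaussianLimitNotScreenedRegressionDefs
import Summits.CriticalPhenomena.Ising3DConformalLimit.Theorems.PerfectScreeningGaussianLimitNotScreenedCrossTermLimit
import Mathlib.Analysis.BoxIntegral.UnitPartition
import Mathlib.MeasureTheory.Measure.Haar.InnerProductSpace
import Mathlib.Topology.UniformSpace.HeineCantor
import Mathlib.Analysis.Normed.Group.Bounded
import HarnessLib

/-!
# Autocorrelation reduction of the layer double sum (stub B2a)

Stub `stub_doubleTermAutocorrelation` (B2a) of line `single-layer-linear-regression` for the crux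
`GaussianLimitNotScreened` (stmt-CriticalPhenomena-13886). THEOREM-ONLY; pure bookkeeping over the
layer, no scaling-limit input. For a continuous profile `φ` on `ℝ² = EuclideanSpace ℝ (Fin 2)`
vanishing outside the ball of radius `R`, with `c_u = n⁻² φ(u/n)` (`profileCoeff`) and the layer
kernel `K(z) = ⟨σ₀σ_{(0,z)}⟩_{β_c} ≥ 0` (`criticalTwoPoint 3 (Fin.cons 0 z)`; Griffiths,
`criticalTwoPoint_nonneg'`), for every `η > 0` and all large `n`:
`|Σ_{u,v ∈ layerBox R n} c_u c_v K(u − v) − Σ_{z ∈ layerBox 2R n} n⁻² Ψ(z/n) K(z)| ≤ η · Σ_z n⁻² K(z)`,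
where `Ψ(x) = ∫ φ(y) φ(y − x) dy` is the autocorrelation of `φ`.

Mechanism: (1) reindex by `z = u − v` (`Finset.sum_map` with `Equiv.subLeft u`, `Finset.sum_subset`:
`c_w = 0` unless `w ∈ layerBox R n`, and `u − v ∈ layerBox 2R n`), so the double sum is
`Σ_z K(z) · Σ_u c_u c_{u−z}`; (2) `Σ_u c_u c_{u−z} = n⁻² · [n⁻² Σ_u φ(u/n) φ(u/n − z/n)]` is `n⁻²` times a
mesh-`1/n` Riemann sum of `y ↦ φ(y) φ(y − x)`, `x = z/n`, and these Riemann sums are within `η` of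
`Ψ(x)` for `n ≥ N(η)` UNIFORMLY in `x`: tile `ℝ²` by the cubes `BoxIntegral.unitPartition.box n ν`
(volume `n⁻²`), on each of which the integrand oscillates by at most `2‖φ‖_∞ ω_φ(2/n)` (`φ` is
uniformly continuous, `HasCompactSupport.uniformContinuous_of_continuous`), and only the
`(2Rn+1)²` cubes indexed by `layerBox R n` carry a nonzero integrand; (3) finish with `K ≥ 0`.
-/

noncomputable section

namespace Summit.CriticalPhenomena.Ising3DConformalLimit.Cruxes.GaussianLimitNotScreened.SingleLayerLinearRegression

open MeasureTheory Filter Topology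
open Literature.Probability.LatticeModels

/-! ### Riemann sums over the mesh-`1/n` tiling of `ℝ^ι`, with an explicit error -/

/-- **Riemann sums with an explicit error.** If `G` is integrable on `ℝ^ι`, vanishes off the
mesh-`1/n` cubes `BoxIntegral.unitPartition.box n ν` indexed by `ν ∈ A`, and oscillates by at most
`ε` between any point of such a cube and its corner `ν/n`, then
`|Σ_{ν ∈ A} n^{-|ι|} G(ν/n) − ∫ G| ≤ |A| · ε · n^{-|ι|}`. [folklore] -/
theorem doubleTerm_riemann_box_estimate {ι : Type*} [Fintype ι] (n : ℕ) [NeZero n]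
    {G : (ι → ℝ) → ℝ} (hG : Integrable G) (A : Finset (ι → ℤ))
    (hA : ∀ y, G y ≠ 0 → BoxIntegral.unitPartition.index n y ∈ A) {ε : ℝ}
    (hε : ∀ ν ∈ A, ∀ y ∈ BoxIntegral.unitPartition.box n ν,
      |G y - G (fun i => (ν i : ℝ) / n)| ≤ ε) :
    |(∑ ν ∈ A, G (fun i => (ν i : ℝ) / n) / (n : ℝ) ^ Fintype.card ι) - ∫ y, G y| ≤
      A.card * ε / (n : ℝ) ^ Fintype.card ι := by
  classical
  set k : ℕ := Fintype.card ι with hk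
  have hmeas : ∀ ν : ι → ℤ,
      MeasurableSet (BoxIntegral.unitPartition.box n ν : Set (ι → ℝ)) :=
    fun ν => (BoxIntegral.unitPartition.box n ν).measurableSet_coe
  have hvol : ∀ ν : ι → ℤ,
      (volume : Measure (ι → ℝ)).real (BoxIntegral.unitPartition.box n ν : Set (ι → ℝ)) =
        1 / (n : ℝ) ^ k := by
    intro ν
    rw [measureReal_def, BoxIntegral.unitPartition.volume_box, ENNReal.toReal_div,
      ENNReal.toReal_pow, ENNReal.toReal_natCast, ENNReal.toReal_one]
  have hfin : ∀ ν : ι → ℤ,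
      volume (BoxIntegral.unitPartition.box n ν : Set (ι → ℝ)) < ⊤ := by
    intro ν
    rw [BoxIntegral.unitPartition.volume_box]
    exact ENNReal.div_lt_top ENNReal.one_ne_top
      (pow_ne_zero _ (Nat.cast_ne_zero.2 (NeZero.ne n)))
  -- `∫ G` splits over the cubes indexed by `A`
  have hsplit : ∫ y, G y =
      ∑ ν ∈ A, ∫ y in (BoxIntegral.unitPartition.box n ν : Set (ι → ℝ)), G y := by
    have h1 : ∫ y in ⋃ ν ∈ A, (BoxIntegral.unitPartition.box n ν : Set (ι → ℝ)), G y = ∫ y, G y := by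
      refine setIntegral_eq_integral_of_forall_compl_eq_zero fun y hy => ?_
      by_contra h
      exact hy (Set.mem_iUnion₂.2
        ⟨_, hA y h, BoxIntegral.unitPartition.mem_box_iff_index.2 rfl⟩)
    have h2 : ∫ y in ⋃ ν ∈ A, (BoxIntegral.unitPartition.box n ν : Set (ι → ℝ)), G y =
        ∑ ν ∈ A, ∫ y in (BoxIntegral.unitPartition.box n ν : Set (ι → ℝ)), G y :=
      integral_biUnion_finset A (fun ν _ => hmeas ν)
        (fun ν _ ν' _ hne => BoxIntegral.unitPartition.disjoint.1 hne)
        (fun ν _ => hG.integrableOn)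
    rw [← h1, h2]
  -- termwise estimate on one cube
  have hterm : ∀ ν ∈ A, |G (fun i => (ν i : ℝ) / n) / (n : ℝ) ^ k -
      ∫ y in (BoxIntegral.unitPartition.box n ν : Set (ι → ℝ)), G y| ≤ ε / (n : ℝ) ^ k := by
    intro ν hν
    have hc : G (fun i => (ν i : ℝ) / n) / (n : ℝ) ^ k =
        ∫ _y in (BoxIntegral.unitPartition.box n ν : Set (ι → ℝ)), G (fun i => (ν i : ℝ) / n) := by
      rw [setIntegral_const, hvol, smul_eq_mul]
      ring
    rw [hc, ← integral_sub ((integrableOn_const (C := G (fun i => (ν i : ℝ) / n)) (hfin ν).ne).integrable)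
      hG.integrableOn.integrable]
    have h := norm_setIntegral_le_of_norm_le_const (hfin ν)
      (f := fun y => G (fun i => (ν i : ℝ) / n) - G y) (C := ε) fun y hy => by
        rw [Real.norm_eq_abs, abs_sub_comm]
        exact hε ν hν y hy
    rw [hvol, Real.norm_eq_abs] at h
    calc _ ≤ ε * (1 / (n : ℝ) ^ k) := h
      _ = ε / (n : ℝ) ^ k := by ring
  -- sum up
  calc |(∑ ν ∈ A, G (fun i => (ν i : ℝ) / n) / (n : ℝ) ^ k) - ∫ y, G y|
      = |∑ ν ∈ A, (G (fun i => (ν i : ℝ) / n) / (n : ℝ) ^ k -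
          ∫ y in (BoxIntegral.unitPartition.box n ν : Set (ι → ℝ)), G y)| := by
        rw [hsplit, Finset.sum_sub_distrib]
    _ ≤ ∑ ν ∈ A, |G (fun i => (ν i : ℝ) / n) / (n : ℝ) ^ k -
          ∫ y in (BoxIntegral.unitPartition.box n ν : Set (ι → ℝ)), G y| :=
        Finset.abs_sum_le_sum_abs _ _
    _ ≤ ∑ ν ∈ A, ε / (n : ℝ) ^ k := Finset.sum_le_sum hterm
    _ = A.card * ε / (n : ℝ) ^ k := by
        rw [Finset.sum_const, nsmul_eq_mul]
        ring

/-! ### Layer bookkeeping: boxes, lattice vectors, discretised profiles -/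

/-- `planeVec` is additive: `(u − z)^ = û − ẑ`. [folklore] -/
theorem doubleTerm_planeVec_sub (u z : Fin 2 → ℤ) : planeVec (u - z) = planeVec u - planeVec z := by
  rw [planeVec, planeVec, planeVec, ← WithLp.toLp_sub]
  congr 1
  funext i
  simp

/-- The rescaled lattice point `u/n` of `ℝ²`, coordinatewise. [folklore] -/
theorem doubleTerm_smul_planeVec (n : ℕ) (u : Fin 2 → ℤ) :
    (n : ℝ)⁻¹ • planeVec u = WithLp.toLp 2 (fun i => (u i : ℝ) / n) := by
  rw [planeVec, ← WithLp.toLp_smul]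
  congr 1
  funext i
  simp [div_eq_inv_mul]

/-- A vector of `ℝ²` with both coordinates of size `≤ δ` has norm `≤ 2δ`. [folklore] -/
theorem doubleTerm_norm_le_two_mul {v : E2} {δ : ℝ} (h : ∀ i, |v i| ≤ δ) : ‖v‖ ≤ 2 * δ := by
  have hδ : 0 ≤ δ := (abs_nonneg _).trans (h 0)
  have h0 := h 0
  have h1 := h 1
  rw [EuclideanSpace.norm_eq, Fin.sum_univ_two, Real.norm_eq_abs, Real.norm_eq_abs,
    Real.sqrt_le_left (by positivity)]
  nlinarith [abs_nonneg (v 0), abs_nonneg (v 1)]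

/-- `u, v ∈ layerBox R n ⇒ u − v ∈ layerBox 2R n`. [folklore] -/
theorem doubleTerm_sub_mem_layerBox {R n : ℕ} {u v : Fin 2 → ℤ} (hu : u ∈ layerBox R n)
    (hv : v ∈ layerBox R n) : u - v ∈ layerBox (2 * R) n := by
  rw [layerBox, Fintype.mem_piFinset] at hu hv ⊢
  intro i
  have h1 := Finset.mem_Icc.1 (hu i)
  have h2 := Finset.mem_Icc.1 (hv i)
  rw [Finset.mem_Icc, Pi.sub_apply, mul_assoc]
  generalize R * n = m at h1 h2 ⊢
  omega

/-- The discretised profile `c_w = n⁻² φ(w/n)` vanishes off `layerBox R n` when `φ` vanishes outside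
the ball of radius `R` (`|wᵢ| ≤ ‖ŵ‖`). [folklore] -/
theorem doubleTerm_profileCoeff_eq_zero {φ : E2 → ℝ} {R : ℕ}
    (hφs : ∀ v : E2, (R : ℝ) ≤ ‖v‖ → φ v = 0) {n : ℕ} (hn : 1 ≤ n) {w : Fin 2 → ℤ}
    (hw : w ∉ layerBox R n) : profileCoeff φ n w = 0 := by
  have hn' : (0 : ℝ) < n := by exact_mod_cast hn
  rw [layerBox, Fintype.mem_piFinset] at hw
  obtain ⟨i, hi⟩ := not_forall.1 hw
  rw [Finset.mem_Icc, not_and_or, not_le, not_le] at hi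
  have habs : (R : ℝ) * n < |(w i : ℝ)| := by
    rcases hi with h | h
    · have h' : ((w i : ℤ) : ℝ) < ((-((R * n : ℕ) : ℤ) : ℤ) : ℝ) := by exact_mod_cast h
      push_cast at h'
      have hneg : (w i : ℝ) < 0 := by
        have : (0 : ℝ) ≤ (R : ℝ) * n := by positivity
        linarith
      rw [abs_of_neg hneg]
      linarith
    · have h' : (((R * n : ℕ) : ℤ) : ℝ) < ((w i : ℤ) : ℝ) := by exact_mod_cast h
      push_cast at h'
      exact h'.trans_le (le_abs_self _)
  have hcoord : |(w i : ℝ)| ≤ ‖planeVec w‖ := by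
    have := PiLp.norm_apply_le (planeVec w) i
    simpa [planeVec] using this
  have hnorm : (R : ℝ) ≤ ‖(n : ℝ)⁻¹ • planeVec w‖ := by
    rw [norm_smul, norm_inv, Real.norm_natCast, le_inv_mul_iff₀ hn']
    linarith
  simp [profileCoeff, hφs _ hnorm]

/-- If `φ(ŷ) ≠ 0` (so `‖ŷ‖ < R`), the mesh-`1/n` cube containing `y` is indexed by `layerBox R n`.
[folklore] -/
theorem doubleTerm_index_mem_layerBox {φ : E2 → ℝ} {R : ℕ}
    (hφs : ∀ v : E2, (R : ℝ) ≤ ‖v‖ → φ v = 0) (n : ℕ) [NeZero n] {y : Fin 2 → ℝ}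
    (hy : φ (WithLp.toLp 2 y) ≠ 0) : BoxIntegral.unitPartition.index n y ∈ layerBox R n := by
  have hn : (0 : ℝ) < n := Nat.cast_pos.2 (Nat.pos_of_neZero n)
  have hR : ‖WithLp.toLp 2 y‖ < R := not_le.1 fun h => hy (hφs _ h)
  rw [layerBox, Fintype.mem_piFinset]
  intro i
  have hi : |y i| < R := by
    have := PiLp.norm_apply_le (WithLp.toLp 2 y) i
    rw [PiLp.toLp_apply, Real.norm_eq_abs] at this
    exact this.trans_lt hR
  rw [abs_lt] at hi
  have hlo : -((R : ℝ) * n) < n * y i := by nlinarith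
  have hhi : n * y i < (R : ℝ) * n := by nlinarith
  rw [Finset.mem_Icc, BoxIntegral.unitPartition.index_apply]
  have h1 : ((-((R * n : ℕ) : ℤ) : ℤ) : ℝ) < n * y i := by push_cast; linarith
  have h2 : (n : ℝ) * y i ≤ (((R * n : ℕ) : ℤ) : ℝ) := by push_cast; linarith
  have h1' := Int.lt_ceil.2 h1
  have h2' := Int.ceil_le.2 h2
  omega

/-! ### The uniform Riemann estimate for the autocorrelation family -/

/-- **Uniform Riemann sums of the autocorrelation family.** For a continuous `φ` vanishing outside
the ball of radius `R` and `η > 0`, for all large `n` and EVERY `x ∈ ℝ²`,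
`|n⁻² Σ_{u ∈ layerBox R n} φ(u/n) φ(u/n − x) − ∫ φ(y) φ(y − x) dy| ≤ η`: the family
`y ↦ φ(y)φ(y − x)` is uniformly bounded by `‖φ‖_∞²`, uniformly equicontinuous (modulus
`2‖φ‖_∞ ω_φ`) and supported in the ball of radius `R`. [folklore] -/
theorem doubleTerm_autocorrelation_riemann_uniform {φ : E2 → ℝ} {R : ℕ} (hφc : Continuous φ)
    (hφs : ∀ v : E2, (R : ℝ) ≤ ‖v‖ → φ v = 0) {η : ℝ} (hη : 0 < η) :
    ∀ᶠ n : ℕ in atTop, ∀ x : E2,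
      |(∑ u ∈ layerBox R n, φ ((n : ℝ)⁻¹ • planeVec u) * φ ((n : ℝ)⁻¹ • planeVec u - x)) /
            (n : ℝ) ^ 2 - ∫ y : E2, φ y * φ (y - x)| ≤ η := by
  -- compact support, sup bound, modulus of continuity
  have hK : HasCompactSupport φ := by
    refine HasCompactSupport.of_support_subset_isCompact (isCompact_closedBall (0 : E2) R)
      fun v hv => ?_
    rw [Metric.mem_closedBall, dist_zero_right]
    by_contra h
    exact hv (hφs v (not_le.1 h).le)
  obtain ⟨M, hM⟩ := hφc.bounded_above_of_compact_support hK
  have hM0 : 0 ≤ M := (norm_nonneg _).trans (hM 0)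
  set C : ℝ := ((2 * R + 1 : ℕ) : ℝ) ^ 2 with hC
  have hC0 : 0 ≤ C := by positivity
  have hden : 0 < 2 * M * C + 1 := by positivity
  set ε' : ℝ := η / (2 * M * C + 1) with hε'
  have hε'0 : 0 < ε' := div_pos hη hden
  obtain ⟨δ, hδ, hδε⟩ :=
    Metric.uniformContinuous_iff.1 (hK.uniformContinuous_of_continuous hφc) ε' hε'0
  have hev : ∀ᶠ n : ℕ in atTop, (2 : ℝ) / n < δ :=
    (tendsto_const_div_atTop_nhds_zero_nat 2).eventually (gt_mem_nhds hδ)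
  filter_upwards [hev, eventually_ge_atTop 1] with n hnδ hn x
  haveI : NeZero n := ⟨by omega⟩
  have hn' : (0 : ℝ) < n := by exact_mod_cast hn
  -- the integrand, read on `Fin 2 → ℝ`
  set G : (Fin 2 → ℝ) → ℝ := fun y => φ (WithLp.toLp 2 y) * φ (WithLp.toLp 2 y - x) with hGdef
  have hFc : Continuous fun v : E2 => φ v * φ (v - x) :=
    hφc.mul (hφc.comp (continuous_id.sub continuous_const))
  have hFi : Integrable (fun v : E2 => φ v * φ (v - x)) :=
    hFc.integrable_of_hasCompactSupport (hK.mul_right (f' := fun v : E2 => φ (v - x)))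
  have hGi : Integrable G :=
    (PiLp.volume_preserving_toLp (Fin 2)).integrable_comp_of_integrable hFi
  have hGint : ∫ y, G y = ∫ v : E2, φ v * φ (v - x) :=
    (PiLp.volume_preserving_toLp (Fin 2)).integral_comp
      (MeasurableEquiv.toLp 2 (Fin 2 → ℝ)).measurableEmbedding (fun v : E2 => φ v * φ (v - x))
  -- support control
  have hA : ∀ y, G y ≠ 0 → BoxIntegral.unitPartition.index n y ∈ layerBox R n :=
    fun y hy => doubleTerm_index_mem_layerBox hφs n (left_ne_zero_of_mul hy)
  -- oscillation on each cube
  have hosc : ∀ ν ∈ layerBox R n, ∀ y ∈ BoxIntegral.unitPartition.box n ν,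
      |G y - G (fun i => (ν i : ℝ) / n)| ≤ 2 * M * ε' := by
    intro ν _ y hy
    rw [BoxIntegral.unitPartition.mem_box_iff] at hy
    set a : E2 := WithLp.toLp 2 y with ha
    set b : E2 := WithLp.toLp 2 (fun i => (ν i : ℝ) / n) with hb
    have hab : dist a b < δ := by
      refine lt_of_le_of_lt ?_ hnδ
      rw [dist_eq_norm, div_eq_mul_one_div]
      refine doubleTerm_norm_le_two_mul fun i => ?_
      have h1 := (hy i).1
      have h2 := (hy i).2
      rw [add_div] at h2
      rw [ha, hb, ← WithLp.toLp_sub, PiLp.toLp_apply, Pi.sub_apply, abs_le]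
      constructor <;> linarith
    have h1 : dist (φ a) (φ b) < ε' := hδε hab
    have h2 : dist (φ (a - x)) (φ (b - x)) < ε' := hδε (by rwa [dist_sub_right])
    rw [Real.dist_eq] at h1 h2
    have hb1 : |φ b| ≤ M := by simpa using hM b
    have ha2 : |φ (a - x)| ≤ M := by simpa using hM (a - x)
    change |φ a * φ (a - x) - φ b * φ (b - x)| ≤ 2 * M * ε'
    calc |φ a * φ (a - x) - φ b * φ (b - x)|
        = |(φ a - φ b) * φ (a - x) + φ b * (φ (a - x) - φ (b - x))| := by ring_nf
      _ ≤ |(φ a - φ b) * φ (a - x)| + |φ b * (φ (a - x) - φ (b - x))| := abs_add_le _ _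
      _ = |φ a - φ b| * |φ (a - x)| + |φ b| * |φ (a - x) - φ (b - x)| := by
          rw [abs_mul, abs_mul]
      _ ≤ ε' * M + M * ε' :=
          add_le_add (mul_le_mul h1.le ha2 (abs_nonneg _) hε'0.le)
            (mul_le_mul hb1 h2.le (abs_nonneg _) hM0)
      _ = 2 * M * ε' := by ring
  -- the cube estimate
  have hest := doubleTerm_riemann_box_estimate n hGi (layerBox R n) hA hosc
  rw [Fintype.card_fin, hGint] at hest
  have hsum : ∑ ν ∈ layerBox R n, G (fun i => (ν i : ℝ) / n) / (n : ℝ) ^ 2 =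
      (∑ u ∈ layerBox R n, φ ((n : ℝ)⁻¹ • planeVec u) *
        φ ((n : ℝ)⁻¹ • planeVec u - x)) / (n : ℝ) ^ 2 := by
    rw [Finset.sum_div]
    refine Finset.sum_congr rfl fun u _ => ?_
    rw [doubleTerm_smul_planeVec]
  rw [hsum] at hest
  refine hest.trans ?_
  -- counting the cubes
  have hcard : ((layerBox R n).card : ℝ) ≤ C * (n : ℝ) ^ 2 := by
    have h1 : (layerBox R n).card = (2 * (R * n) + 1) ^ 2 := by
      rw [layerBox, Fintype.card_piFinset, Finset.prod_const, Finset.card_univ, Fintype.card_fin,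
        Int.card_Icc]
      congr 1
      omega
    rw [h1, hC]
    push_cast
    rw [← mul_pow]
    have hn1 : (1 : ℝ) ≤ n := by exact_mod_cast hn
    have h2 : (2 * ((R : ℝ) * n) + 1) ≤ (2 * R + 1) * n := by nlinarith
    exact pow_le_pow_left₀ (by positivity) h2 2
  have hMε : 0 ≤ 2 * M * ε' := by positivity
  calc ((layerBox R n).card : ℝ) * (2 * M * ε') / (n : ℝ) ^ 2
      ≤ C * (n : ℝ) ^ 2 * (2 * M * ε') / (n : ℝ) ^ 2 :=
        div_le_div_of_nonneg_right (mul_le_mul_of_nonneg_right hcard hMε) (by positivity)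
    _ = 2 * M * C * ε' := by
        field_simp
    _ = η * (2 * M * C) / (2 * M * C + 1) := by
        rw [hε']
        ring
    _ ≤ η := by
        rw [div_le_iff₀ hden]
        nlinarith [mul_nonneg (mul_nonneg (zero_le_two (α := ℝ)) hM0) hC0]

/-! ### The stub -/

/-- **Stub B2a** (`stub_doubleTermAutocorrelation`): for a continuous profile `φ` vanishing outside
the ball of radius `R` and every `η > 0`, for all large `n`,
`|Σ_{u,v ∈ layerBox R n} n⁻²φ(u/n)·n⁻²φ(v/n)·G((0,u−v)) − Σ_{z ∈ layerBox 2R n} n⁻²Ψ(z/n)·G((0,z))|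
≤ η·Σ_{z ∈ layerBox 2R n} n⁻²G((0,z))`, `Ψ(x) = ∫ φ(y)φ(y−x)dy`. Reindex by `z = u − v`, bound the
inner sums by the uniform Riemann estimate `doubleTerm_autocorrelation_riemann_uniform`, and finish
with `G ≥ 0` (`criticalTwoPoint_nonneg'`). [folklore] -/
theorem stub_doubleTermAutocorrelation :
    ∀ (φ : E2 → ℝ) (R : ℕ), Continuous φ → (∀ v : E2, (R : ℝ) ≤ ‖v‖ → φ v = 0) →
      ∀ η : ℝ, 0 < η → ∀ᶠ n : ℕ in atTop,
        |(∑ u ∈ layerBox R n, ∑ v ∈ layerBox R n,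
            profileCoeff φ n u * profileCoeff φ n v * criticalTwoPoint 3 (Fin.cons 0 (u - v))) -
          ∑ z ∈ layerBox (2 * R) n,
            (∫ y : E2, φ y * φ (y - (n : ℝ)⁻¹ • planeVec z)) / (n : ℝ) ^ 2 *
              criticalTwoPoint 3 (Fin.cons 0 z)| ≤
        η * ∑ z ∈ layerBox (2 * R) n, criticalTwoPoint 3 (Fin.cons 0 z) / (n : ℝ) ^ 2 := by
  intro φ R hφc hφs η hη
  filter_upwards [doubleTerm_autocorrelation_riemann_uniform hφc hφs hη, eventually_ge_atTop 1]
    with n hU hn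
  have hn' : (0 : ℝ) < n := by exact_mod_cast hn
  -- Step 1: reindex the double sum by `z = u - v`
  have hre : ∑ u ∈ layerBox R n, ∑ v ∈ layerBox R n,
        profileCoeff φ n u * profileCoeff φ n v * criticalTwoPoint 3 (Fin.cons 0 (u - v)) =
      ∑ z ∈ layerBox (2 * R) n, (∑ u ∈ layerBox R n,
        profileCoeff φ n u * profileCoeff φ n (u - z)) * criticalTwoPoint 3 (Fin.cons 0 z) := by
    have inner : ∀ u ∈ layerBox R n, ∑ v ∈ layerBox R n,
        profileCoeff φ n u * profileCoeff φ n v * criticalTwoPoint 3 (Fin.cons 0 (u - v)) =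
        ∑ z ∈ layerBox (2 * R) n,
          profileCoeff φ n u * profileCoeff φ n (u - z) * criticalTwoPoint 3 (Fin.cons 0 z) := by
      intro u hu
      have h1 : ∑ v ∈ layerBox R n,
          profileCoeff φ n u * profileCoeff φ n v * criticalTwoPoint 3 (Fin.cons 0 (u - v)) =
          ∑ z ∈ (layerBox R n).map (Equiv.subLeft u).toEmbedding,
            profileCoeff φ n u * profileCoeff φ n (u - z) * criticalTwoPoint 3 (Fin.cons 0 z) := by
        rw [Finset.sum_map]
        refine Finset.sum_congr rfl fun v _ => ?_
        simp only [Equiv.coe_toEmbedding, Equiv.subLeft_apply, sub_sub_cancel]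
      rw [h1]
      refine Finset.sum_subset (fun z hz => ?_) (fun z _ hz => ?_)
      · rw [Finset.mem_map] at hz
        obtain ⟨v, hv, rfl⟩ := hz
        exact doubleTerm_sub_mem_layerBox hu hv
      · have hz' : u - z ∉ layerBox R n := fun h =>
          hz (Finset.mem_map.2 ⟨u - z, h, by simp⟩)
        rw [doubleTerm_profileCoeff_eq_zero hφs hn hz', mul_zero, zero_mul]
    rw [Finset.sum_congr rfl inner, Finset.sum_comm]
    refine Finset.sum_congr rfl fun z _ => ?_
    rw [Finset.sum_mul]
  -- Step 2: the inner sums are Riemann sums of the autocorrelation, uniformly in `z`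
  have hz : ∀ z : Fin 2 → ℤ,
      |(∑ u ∈ layerBox R n, profileCoeff φ n u * profileCoeff φ n (u - z)) -
        (∫ y : E2, φ y * φ (y - (n : ℝ)⁻¹ • planeVec z)) / (n : ℝ) ^ 2| ≤ η / (n : ℝ) ^ 2 := by
    intro z
    have hsum : ∑ u ∈ layerBox R n, profileCoeff φ n u * profileCoeff φ n (u - z) =
        (∑ u ∈ layerBox R n, φ ((n : ℝ)⁻¹ • planeVec u) *
          φ ((n : ℝ)⁻¹ • planeVec u - (n : ℝ)⁻¹ • planeVec z)) / (n : ℝ) ^ 2 / (n : ℝ) ^ 2 := by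
      rw [Finset.sum_div, Finset.sum_div]
      refine Finset.sum_congr rfl fun u _ => ?_
      rw [profileCoeff, profileCoeff, doubleTerm_planeVec_sub, smul_sub]
      ring
    have hn2 : (0 : ℝ) < (n : ℝ) ^ 2 := by positivity
    rw [hsum, ← sub_div, abs_div, abs_of_pos hn2]
    exact div_le_div_of_nonneg_right (hU _) hn2.le
  -- Step 3: conclude with `K ≥ 0`
  rw [hre, ← Finset.sum_sub_distrib, Finset.mul_sum]
  refine (Finset.abs_sum_le_sum_abs _ _).trans (Finset.sum_le_sum fun z _ => ?_)
  rw [← sub_mul, abs_mul, abs_of_nonneg (criticalTwoPoint_nonneg' _)]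
  calc |(∑ u ∈ layerBox R n, profileCoeff φ n u * profileCoeff φ n (u - z)) -
          (∫ y : E2, φ y * φ (y - (n : ℝ)⁻¹ • planeVec z)) / (n : ℝ) ^ 2| *
        criticalTwoPoint 3 (Fin.cons 0 z)
      ≤ η / (n : ℝ) ^ 2 * criticalTwoPoint 3 (Fin.cons 0 z) :=
        mul_le_mul_of_nonneg_right (hz z) (criticalTwoPoint_nonneg' _)
    _ = η * (criticalTwoPoint 3 (Fin.cons 0 z) / (n : ℝ) ^ 2) := by ring

end Summit.CriticalPhenomena.Ising3DConformalLimit.Cruxes.GaussianLimitNotScreened.SingleLayerLinearRegression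

end
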